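import Literature.NumberTheory.Automorphic.AutomorphicTwistSatake
import HarnessLib

/-!
# The complex conjugate `π̄` of a cuspidal automorphic representation (contragredient of unitary `π`)

Topic `NumberTheory/Automorphic`; namespaces `ContRepresentation.ClosedSubrep` (generic transport),
`Literature.NumberTheory.Automorphic.AdelicGroupData` (conjugation on `L²`), `Literature.Automorphic` (`GL_n`). In the tree's
model, a cuspidal automorphic representation of `GL_n(𝔸_K)` is a closed irreducible `GL_n(𝔸_K)`-stable
subspace `π ≤ L²_cusp(GL_n(K) A_G \ GL_n(𝔸_K))` (`CuspidalAutomorphicRepGL`). Complex conjugation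
`f ↦ f̄` is a conjugate-linear isometry of `L²` commuting with right translations, so
`π̄ = {f̄ : f ∈ π}` is again a cuspidal automorphic representation; as an abstract representation it
is the complex conjugate of `π`, i.e. (since `π` is unitary) its **contragredient `π̃`** — the object
entering the Jacquet–Shalika facts (2.2)–(2.4) and the proof of Thm. 3.1 of Arthur–Clozel, *Simple
algebras, base change, and the advanced theory of the trace formula*, Ch. 3 (p. 171: "`σ̃`, the
contragredient of `σ`"; p. 172: "`t̃'_v` denoting the adjoint of `t'_v`"). Everything here is
**proved**; there are no new facts.

* Generic (`ContRepresentation.ClosedSubrep`, any `σ`-semilinear topological isomorphism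
  `e : V ≃SL[σ] V'` with `e ∘ π(g) = π'(g) ∘ e`, `IsSemilinearEquivariant`): transport
  `mapSemilinear` of closed subrepresentations, the order isomorphism `mapSemilinearOrderIso`,
  invariance of topological irreducibility (`isTopIrreducible_iff_of_isSemilinearEquivariant`,
  `isTopIrreducible_mapSemilinear_iff`), the restricted isomorphism `mapSemilinearEquiv`, fixed
  vectors (`mapSemilinearEquiv_mem_fixedVectors_iff`) and **Hecke operators commute with `e`**
  (`heckeOperatorAt_mapSemilinear_mapSemilinearEquiv`). (The linear twisted and the
  group-automorphism variants are `mapTwisted` of `AutomorphicTwist` and `mapConj` of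
  `AutomorphicGaloisConj`.)
* `L²` (`AdelicGroupData`, any `𝒢`): `conjL2 : L² ≃ₗᵢ⋆[ℂ] L²` (Mathlib's `star` on `Lp`, bundled;
  `L2.star_add`, `L2.star_smul`, `L2.norm_star`, `coeFn_conjL2`, `conjL2_toLp`), and
  **`R(g) f̄ = \overline{R(g) f}`** (`rightRegular_conjL2`, `isSemilinearEquivariant_conjL2`).
* `ClosedSubrep.conj W = W̄` (+ `mem_conj_iff`, `conj_conj`, `conj_inj`, `conjEquiv`,
  `isTopIrreducible_conj_iff`, `conjEquiv_mem_fixedVectors_iff`, `heckeOperatorAt_conj_conjEquiv`).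
* `GL_n`: conjugates of cusp forms are cusp forms (`ConstantTermVanishes.star`,
  `star_mem_cuspForms`, `conjL2_mem_cuspidalSubspace`, `conj_le_cuspidalSubspace`);
  **`CuspidalAutomorphicRepGL.conj π = π̄`** (+ `conj_conj`, `conj_injective`,
  `conj_eq_iff_eq_conj`); **Satake parameters of the conjugate are the conjugates**:
  `HasSatakeParameterAt.conj` (`α ↦ ᾱ`; the Hecke operators are real and the eigenvalues
  `q_v^{i(n-i)/2} e_i(α)` conjugate to `q_v^{i(n-i)/2} e_i(ᾱ)`, `Multiset.esymm_map_ringHom`),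
  `hasSatakeParameterAt_conj_iff`, `isUnramifiedAt_conj_iff`, `IsSatakeFamilyOf.conj` / `of_conj`
  (`t_{π̄,v} = \bar t_{π,v}`, for unitary unramified `π_v` the conjugacy class of `t_{π,v}^{-1} = t_{π̃,v}`).

Note: files that *define* a declaration named `conj` must not `open scoped ComplexConjugate`
(the notation `conj` would capture the identifier); this file writes `starRingEnd ℂ`.

## References

* J. Arthur, L. Clozel, *Simple algebras, base change, and the advanced theory of the trace
  formula*, Ann. of Math. Stud. 120 (1989), Ch. 3 §2 (p. 171) and proof of Thm. 3.1 (p. 172).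
  [ArthurClozelAMS120]
* A. Borel, H. Jacquet, *Automorphic forms and automorphic representations*, Corvallis (1979),
  §4.6. [BorelJacquetCorvallis1979]
-/

noncomputable section

open scoped MatrixGroups
open NumberField IsDedekindDomain MeasureTheory

/-! ### Closed subrepresentations under semilinear equivariant isomorphisms (generic) -/

namespace ContRepresentation.ClosedSubrep

section MapSemilinear

variable {k G V V' : Type*} [CommRing k] [Monoid G]
  [AddCommGroup V] [TopologicalSpace V] [IsTopologicalAddGroup V] [Module k V]
  [AddCommGroup V'] [TopologicalSpace V'] [IsTopologicalAddGroup V'] [Module k V']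
  {σ σ' : k →+* k} [RingHomInvPair σ σ'] [RingHomInvPair σ' σ]
  {π : ContRepresentation k G V} {π' : ContRepresentation k G V'}

/-- A `σ`-semilinear topological isomorphism `e : V ≃SL[σ] V'` is **equivariant** from `π` to
`π'` if `e (π g v) = π' g (e v)` for all `g`, `v` (e.g. complex conjugation on `L²`, which is
conjugate-linear and commutes with translations). [folklore] -/
def IsSemilinearEquivariant (π : ContRepresentation k G V) (π' : ContRepresentation k G V')
    (e : V ≃SL[σ] V') : Prop :=
  ∀ g v, e (π g v) = π' g (e v)

variable {e : V ≃SL[σ] V'}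

/-- The inverse of a semilinear equivariant isomorphism is equivariant. [folklore] -/
theorem IsSemilinearEquivariant.symm (he : IsSemilinearEquivariant π π' e) :
    IsSemilinearEquivariant π' π e.symm := by
  intro g v'
  apply e.injective
  rw [e.apply_symm_apply, he, e.apply_symm_apply]

/-- **Transport of a closed subrepresentation along a semilinear equivariant isomorphism**: the
image `e(W)` is a closed `π'`-invariant subspace. [folklore] -/
def mapSemilinear (W : ClosedSubrep π) (he : IsSemilinearEquivariant π π' e) : ClosedSubrep π' where
  toSubmodule := W.toSubmodule.map (e : V →ₛₗ[σ] V')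
  apply_mem_toSubmodule g := by
    rintro _ ⟨v, hv, rfl⟩
    exact ⟨π g v, W.apply_mem g hv, he g v⟩
  isClosed' := by
    change IsClosed ((W.toSubmodule.map (e : V →ₛₗ[σ] V') : Submodule k V') : Set V')
    rw [Submodule.map_coe]
    exact e.isClosed_image.mpr W.isClosed

/-- The submodule underlying `W.mapSemilinear he` is the image `e(W)` (definitional). [folklore] -/
@[simp]
theorem toSubmodule_mapSemilinear (W : ClosedSubrep π) (he : IsSemilinearEquivariant π π' e) :
    (W.mapSemilinear he).toSubmodule = W.toSubmodule.map (e : V →ₛₗ[σ] V') := rfl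

/-- `v' ∈ e(W) ↔ e⁻¹ v' ∈ W`. [folklore] -/
theorem mem_mapSemilinear_iff (W : ClosedSubrep π) (he : IsSemilinearEquivariant π π' e) {v' : V'} :
    v' ∈ W.mapSemilinear he ↔ e.symm v' ∈ W := by
  change v' ∈ W.toSubmodule.map (e : V →ₛₗ[σ] V') ↔ _
  constructor
  · rintro ⟨v, hv, rfl⟩
    change e.symm (e v) ∈ W
    rwa [e.symm_apply_apply]
  · intro h
    exact ⟨e.symm v', h, e.apply_symm_apply v'⟩

/-- `e w ∈ e(W)` for `w ∈ W`. [folklore] -/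
theorem apply_mem_mapSemilinear (W : ClosedSubrep π) (he : IsSemilinearEquivariant π π' e) {v : V}
    (hv : v ∈ W) : e v ∈ W.mapSemilinear he :=
  (W.mem_mapSemilinear_iff he).mpr (by rwa [e.symm_apply_apply])

/-- `e⁻¹(e(W)) = W`. [folklore] -/
theorem mapSemilinear_mapSemilinear_symm (W : ClosedSubrep π) (he : IsSemilinearEquivariant π π' e) :
    (W.mapSemilinear he).mapSemilinear he.symm = W := by
  ext v
  rw [mem_mapSemilinear_iff, mem_mapSemilinear_iff, e.symm_symm, e.symm_apply_apply]

/-- `e(e⁻¹(W')) = W'`. [folklore] -/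
theorem mapSemilinear_symm_mapSemilinear (W' : ClosedSubrep π')
    (he : IsSemilinearEquivariant π π' e) : (W'.mapSemilinear he.symm).mapSemilinear he = W' := by
  ext v
  rw [mem_mapSemilinear_iff, mem_mapSemilinear_iff, e.symm_symm, e.apply_symm_apply]

/-- `e(W₁) ≤ e(W₂) ↔ W₁ ≤ W₂`. [folklore] -/
theorem mapSemilinear_le_mapSemilinear_iff {W₁ W₂ : ClosedSubrep π}
    (he : IsSemilinearEquivariant π π' e) :
    W₁.mapSemilinear he ≤ W₂.mapSemilinear he ↔ W₁ ≤ W₂ := by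
  constructor
  · intro h v hv
    have := h (W₁.apply_mem_mapSemilinear he hv)
    rwa [mem_mapSemilinear_iff, e.symm_apply_apply] at this
  · intro h v' hv'
    rw [mem_mapSemilinear_iff] at hv' ⊢
    exact h hv'

/-- Transport along a semilinear equivariant isomorphism is an **order isomorphism** of the
lattices of closed subrepresentations. [folklore] -/
def mapSemilinearOrderIso (he : IsSemilinearEquivariant π π' e) : ClosedSubrep π ≃o ClosedSubrep π' where
  toFun W := W.mapSemilinear he
  invFun W' := W'.mapSemilinear he.symm
  left_inv W := W.mapSemilinear_mapSemilinear_symm he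
  right_inv W' := W'.mapSemilinear_symm_mapSemilinear he
  map_rel_iff' := mapSemilinear_le_mapSemilinear_iff he

/-- Unfolding `mapSemilinearOrderIso`. [folklore] -/
@[simp]
theorem mapSemilinearOrderIso_apply (he : IsSemilinearEquivariant π π' e) (W : ClosedSubrep π) :
    mapSemilinearOrderIso he W = W.mapSemilinear he := rfl

/-- **Topological irreducibility is invariant under semilinear equivariant isomorphisms.**
[folklore] -/
theorem isTopIrreducible_iff_of_isSemilinearEquivariant [T1Space V] [T1Space V']
    (he : IsSemilinearEquivariant π π' e) : π.IsTopIrreducible ↔ π'.IsTopIrreducible :=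
  (mapSemilinearOrderIso he).isSimpleOrder_iff

/-- The restriction `W ≃SL e(W)` of `e` to a closed subrepresentation. [folklore] -/
def mapSemilinearEquiv (W : ClosedSubrep π) (he : IsSemilinearEquivariant π π' e) :
    W.toSubmodule ≃SL[σ] (W.mapSemilinear he).toSubmodule :=
  e.ofSubmodules _ _ rfl

/-- `mapSemilinearEquiv` is `e` on vectors (definitional). [folklore] -/
@[simp]
theorem coe_mapSemilinearEquiv_apply (W : ClosedSubrep π) (he : IsSemilinearEquivariant π π' e)
    (w : W.toSubmodule) : (W.mapSemilinearEquiv he w : V') = e w :=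
  rfl

/-- The restriction `W ≃SL e(W)` is equivariant for the restricted representations. [folklore] -/
theorem isSemilinearEquivariant_mapSemilinearEquiv (W : ClosedSubrep π)
    (he : IsSemilinearEquivariant π π' e) :
    IsSemilinearEquivariant W.toContRep (W.mapSemilinear he).toContRep (W.mapSemilinearEquiv he) := by
  intro g w
  refine Subtype.ext ?_
  rw [coe_mapSemilinearEquiv_apply, coe_toContRep_apply, coe_toContRep_apply,
    coe_mapSemilinearEquiv_apply]
  exact he g w

/-- **`e(W)` is irreducible iff `W` is.** [folklore] -/
theorem isTopIrreducible_mapSemilinear_iff [T1Space V] [T1Space V'] (W : ClosedSubrep π)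
    (he : IsSemilinearEquivariant π π' e) :
    (W.mapSemilinear he).toContRep.IsTopIrreducible ↔ W.toContRep.IsTopIrreducible :=
  (isTopIrreducible_iff_of_isSemilinearEquivariant
    (W.isSemilinearEquivariant_mapSemilinearEquiv he)).symm

end MapSemilinear

section HeckeSemilinear

variable {k G V V' : Type*} [CommRing k] [Group G]
  [AddCommGroup V] [TopologicalSpace V] [IsTopologicalAddGroup V] [Module k V]
  [AddCommGroup V'] [TopologicalSpace V'] [IsTopologicalAddGroup V'] [Module k V']
  {σ σ' : k →+* k} [RingHomInvPair σ σ'] [RingHomInvPair σ' σ]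
  {π : ContRepresentation k G V} {π' : ContRepresentation k G V'} {e : V ≃SL[σ] V'}

/-- `e` maps `Kf`-fixed vectors of `W` to `Kf`-fixed vectors of `e(W)`. [folklore] -/
theorem mapSemilinearEquiv_mem_fixedVectors_iff (W : ClosedSubrep π)
    (he : IsSemilinearEquivariant π π' e) {Kf : Subgroup G} {w : W.toSubmodule} :
    W.mapSemilinearEquiv he w ∈ (W.mapSemilinear he).fixedVectors Kf ↔ w ∈ W.fixedVectors Kf := by
  rw [mem_fixedVectors, mem_fixedVectors]
  have hE := W.isSemilinearEquivariant_mapSemilinearEquiv he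
  constructor
  · intro h x hx
    apply (W.mapSemilinearEquiv he).injective
    rw [hE x w]
    exact h x hx
  · intro h x hx
    rw [← hE x w, h x hx]

open Literature.NumberTheory.Automorphic in
/-- **Hecke operators commute with semilinear equivariant isomorphisms**: for `w ∈ W^{Kf}`,
`[Kf g Kf] (e w) = e ([Kf g Kf] w)` (each summand `π'(x) (e w) = e (π(x) w)`; in the junk case of
an infinite double coset both sides vanish). [folklore] -/
theorem heckeOperatorAt_mapSemilinear_mapSemilinearEquiv (W : ClosedSubrep π)
    (he : IsSemilinearEquivariant π π' e) (Kf : Subgroup G) (g : G) {w : W.toSubmodule}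
    (hw : w ∈ W.fixedVectors Kf) :
    heckeOperatorAt (W.mapSemilinear he) Kf g (W.mapSemilinearEquiv he w) =
      W.mapSemilinearEquiv he (heckeOperatorAt W Kf g w) := by
  classical
  have hE := W.isSemilinearEquivariant_mapSemilinearEquiv he
  by_cases hfin : (MulAction.orbit Kf (g : G ⧸ Kf)).Finite
  · set s : Finset G := hfin.toFinset.image Quotient.out with hs
    have hbij : Set.BijOn (fun x : G => (x : G ⧸ Kf)) s (MulAction.orbit Kf (g : G ⧸ Kf)) := by
      refine ⟨?_, ?_, ?_⟩
      · intro x hx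
        obtain ⟨y, hy, rfl⟩ := Finset.mem_image.1 hx
        rw [Set.Finite.mem_toFinset] at hy
        simpa only [QuotientGroup.out_eq'] using hy
      · intro x hx x' hx' h
        obtain ⟨y, -, rfl⟩ := Finset.mem_image.1 hx
        obtain ⟨y', -, rfl⟩ := Finset.mem_image.1 hx'
        simp only [QuotientGroup.out_eq'] at h
        rw [h]
      · intro y hy
        refine ⟨y.out, Finset.mem_image.2 ⟨y, (Set.Finite.mem_toFinset _).2 hy, rfl⟩, ?_⟩
        exact QuotientGroup.out_eq' y
    have hw' := (W.mapSemilinearEquiv_mem_fixedVectors_iff he).2 hw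
    rw [heckeOperatorAt, heckeOperatorAt,
      heckeOperator_apply_eq_sum _ Kf g s hbij hw', heckeOperator_apply_eq_sum _ Kf g s hbij hw,
      map_sum]
    refine Finset.sum_congr rfl fun x _ => ?_
    exact (hE x w).symm
  · have hinf : (MulAction.orbit Kf (g : G ⧸ Kf)).Infinite := hfin
    rw [heckeOperatorAt, heckeOperatorAt, heckeOperator_eq_zero_of_infinite _ Kf g hinf,
      heckeOperator_eq_zero_of_infinite _ Kf g hinf, LinearMap.zero_apply, LinearMap.zero_apply,
      map_zero]

end HeckeSemilinear

end ContRepresentation.ClosedSubrep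

/-! ### Complex conjugation on `L²` of the automorphic quotient -/

namespace Literature.NumberTheory.Automorphic

namespace AdelicGroupData

universe u

variable {K : Type} [Field K] [NumberField K] (𝒢 : AdelicGroupData.{u} K)
  (μ : Measure 𝒢.automorphicQuotient)

/-- `star (f + g) = star f + star g` in `L²`. [folklore] -/
theorem L2.star_add (f g : 𝒢.L2 μ) : star (f + g) = star f + star g := by
  refine Lp.ext ?_
  filter_upwards [Lp.coeFn_star (f + g), Lp.coeFn_add f g, Lp.coeFn_add (star f) (star g),
    Lp.coeFn_star f, Lp.coeFn_star g] with x h1 h2 h3 h4 h5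
  simp only [h1, h3, Pi.star_apply, Pi.add_apply, h2, h4, h5, RCLike.star_def, map_add]

/-- `star (c • f) = c̄ • star f` in `L²`. [folklore] -/
theorem L2.star_smul (c : ℂ) (f : 𝒢.L2 μ) : star (c • f) = (starRingEnd ℂ) c • star f := by
  refine Lp.ext ?_
  filter_upwards [Lp.coeFn_star (c • f), Lp.coeFn_smul c f, Lp.coeFn_smul ((starRingEnd ℂ) c) (star f),
    Lp.coeFn_star f] with x h1 h2 h3 h4
  simp only [h1, h3, Pi.star_apply, Pi.smul_apply, h2, h4, RCLike.star_def, smul_eq_mul, map_mul]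

/-- `‖star f‖ = ‖f‖` in `L²`. [folklore] -/
theorem L2.norm_star (f : 𝒢.L2 μ) : ‖star f‖ = ‖f‖ := by
  rw [Lp.norm_def, Lp.norm_def, eLpNorm_congr_ae (Lp.coeFn_star f), eLpNorm_star]

/-- **Complex conjugation `f ↦ f̄` on `L²(G(𝔸_K) ⧸ A_G G(K), μ)`** as a conjugate-linear isometric
isomorphism (Mathlib's `star` on `Lp`, bundled). [folklore] -/
def conjL2 : 𝒢.L2 μ ≃ₗᵢ⋆[ℂ] 𝒢.L2 μ where
  toFun := star
  invFun := star
  map_add' := L2.star_add 𝒢 μ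
  map_smul' := L2.star_smul 𝒢 μ
  left_inv := star_star
  right_inv := star_star
  norm_map' := L2.norm_star 𝒢 μ

/-- `conjL2 f = star f` (definitional). [folklore] -/
@[simp]
theorem conjL2_apply (f : 𝒢.L2 μ) : 𝒢.conjL2 μ f = star f := rfl

/-- `conjL2 f = f̄` almost everywhere. [folklore] -/
theorem coeFn_conjL2 (f : 𝒢.L2 μ) :
    (𝒢.conjL2 μ f : 𝒢.automorphicQuotient → ℂ) =ᵐ[μ] fun x => (starRingEnd ℂ) (f x) := by
  filter_upwards [Lp.coeFn_star f] with x hx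
  rw [conjL2_apply, hx, Pi.star_apply, RCLike.star_def]

/-- `conjL2 (conjL2 f) = f`. [folklore] -/
@[simp]
theorem conjL2_conjL2 (f : 𝒢.L2 μ) : 𝒢.conjL2 μ (𝒢.conjL2 μ f) = f := star_star f

/-- `conjL2` is its own inverse. [folklore] -/
@[simp]
theorem conjL2_symm : (𝒢.conjL2 μ).symm = 𝒢.conjL2 μ := rfl

/-- On the class of a square-integrable function, `conjL2 [φ] = [φ̄]`. [folklore] -/
theorem conjL2_toLp {φ : 𝒢.automorphicQuotient → ℂ} (hφ : MemLp φ 2 μ) :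
    𝒢.conjL2 μ (hφ.toLp φ) = hφ.star.toLp (star φ) := by
  refine Lp.ext ?_
  filter_upwards [𝒢.coeFn_conjL2 μ (hφ.toLp φ), hφ.coeFn_toLp, hφ.star.coeFn_toLp] with x h1 h2 h3
  rw [h1, h2, h3, Pi.star_apply, RCLike.star_def]

variable [SMulInvariantMeasure 𝒢.Adelic 𝒢.automorphicQuotient μ]

/-- **Conjugation commutes with the regular representation**: `R(g) f̄ = \overline{R(g) f}`.
[folklore] -/
theorem rightRegular_conjL2 (g : 𝒢.Adelic) (f : 𝒢.L2 μ) :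
    𝒢.rightRegular μ g (𝒢.conjL2 μ f) = 𝒢.conjL2 μ (𝒢.rightRegular μ g f) := by
  refine Lp.ext ?_
  have h1 := 𝒢.rightRegular_apply_coeFn μ g (𝒢.conjL2 μ f)
  have h2 : (fun x => (𝒢.conjL2 μ f : 𝒢.automorphicQuotient → ℂ) (g⁻¹ • x)) =ᵐ[μ]
      fun x => (starRingEnd ℂ) (f (g⁻¹ • x)) :=
    (measurePreserving_smul g⁻¹ μ).quasiMeasurePreserving.ae_eq_comp (𝒢.coeFn_conjL2 μ f)
  have h3 := 𝒢.coeFn_conjL2 μ (𝒢.rightRegular μ g f)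
  have h4 := 𝒢.rightRegular_apply_coeFn μ g f
  filter_upwards [h1, h2, h3, h4] with x h1 h2 h3 h4
  rw [h1, h2, h3, h4]

/-- `conjL2` is a (conjugate-linear) equivariant isomorphism of the regular representation.
[folklore] -/
theorem isSemilinearEquivariant_conjL2 :
    ContRepresentation.ClosedSubrep.IsSemilinearEquivariant (𝒢.rightRegular μ) (𝒢.rightRegular μ)
      (𝒢.conjL2 μ).toContinuousLinearEquiv :=
  fun g f => (𝒢.rightRegular_conjL2 μ g f).symm

end AdelicGroupData

end Literature.NumberTheory.Automorphic

/-! ### The complex conjugate of a closed subrepresentation of `L²` -/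

namespace ContRepresentation.ClosedSubrep

open Literature.NumberTheory.Automorphic Literature.NumberTheory.Automorphic.AdelicGroupData

universe u

variable {K : Type} [Field K] [NumberField K] {𝒢 : AdelicGroupData.{u} K}
  {μ : Measure 𝒢.automorphicQuotient} [SMulInvariantMeasure 𝒢.Adelic 𝒢.automorphicQuotient μ]
  (W : ClosedSubrep (𝒢.rightRegular μ))

/-- **The complex conjugate `W̄ = {f̄ : f ∈ W}` of a closed subrepresentation `W ≤ L²`**: a closed
invariant subspace (conjugation is a conjugate-linear isometry commuting with `R(g)`), realising
the complex-conjugate representation of `W`, which for unitary `W` is its contragredient `W̃`.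
[folklore] -/
def conj : ClosedSubrep (𝒢.rightRegular μ) :=
  W.mapSemilinear (isSemilinearEquivariant_conjL2 𝒢 μ)

/-- `f ∈ W̄ ↔ f̄ ∈ W`. [folklore] -/
theorem mem_conj_iff {f : 𝒢.L2 μ} : f ∈ W.conj ↔ star f ∈ W :=
  W.mem_mapSemilinear_iff _

/-- `f̄ ∈ W̄` for `f ∈ W`. [folklore] -/
theorem star_mem_conj {f : 𝒢.L2 μ} (hf : f ∈ W) : star f ∈ W.conj := by
  rw [mem_conj_iff, star_star]; exact hf

/-- `conj (conj W) = W`. [folklore] -/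
@[simp]
theorem conj_conj : W.conj.conj = W := by
  ext f; rw [mem_conj_iff, mem_conj_iff, star_star]

variable {W} in
/-- `W₁.conj ≤ W₂.conj ↔ W₁ ≤ W₂`. [folklore] -/
theorem conj_le_conj_iff {W₁ W₂ : ClosedSubrep (𝒢.rightRegular μ)} : W₁.conj ≤ W₂.conj ↔ W₁ ≤ W₂ :=
  mapSemilinear_le_mapSemilinear_iff _

/-- `W ↦ W̄` is injective. [folklore] -/
theorem conj_injective :
    Function.Injective (conj : ClosedSubrep (𝒢.rightRegular μ) → ClosedSubrep (𝒢.rightRegular μ)) :=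
  fun W₁ W₂ h => by rw [← conj_conj W₁, h, conj_conj]

variable {W} in
/-- `W₁.conj = W₂.conj ↔ W₁ = W₂`. [folklore] -/
theorem conj_inj {W₁ W₂ : ClosedSubrep (𝒢.rightRegular μ)} : W₁.conj = W₂.conj ↔ W₁ = W₂ :=
  conj_injective.eq_iff

variable {W} in
/-- `W₁.conj = W₂ ↔ W₁ = W₂.conj`. [folklore] -/
theorem conj_eq_iff_eq_conj {W₁ W₂ : ClosedSubrep (𝒢.rightRegular μ)} : W₁.conj = W₂ ↔ W₁ = W₂.conj := by
  rw [← conj_inj (W₁ := W₁.conj), conj_conj]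

/-- The conjugate-linear isomorphism `W ≃ W̄`, `f ↦ f̄`. [folklore] -/
def conjEquiv : W.toSubmodule ≃SL[starRingEnd ℂ] W.conj.toSubmodule :=
  W.mapSemilinearEquiv (isSemilinearEquivariant_conjL2 𝒢 μ)

/-- `conjEquiv f = f̄` on vectors (definitional). [folklore] -/
@[simp]
theorem coe_conjEquiv_apply (f : W.toSubmodule) : (W.conjEquiv f : 𝒢.L2 μ) = star (f : 𝒢.L2 μ) :=
  rfl

/-- **`W̄` is irreducible iff `W` is.** [folklore] -/
theorem isTopIrreducible_conj_iff : W.conj.toContRep.IsTopIrreducible ↔ W.toContRep.IsTopIrreducible :=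
  W.isTopIrreducible_mapSemilinear_iff _

/-- `f̄ ∈ W̄^{Kf} ↔ f ∈ W^{Kf}`. [folklore] -/
theorem conjEquiv_mem_fixedVectors_iff {Kf : Subgroup 𝒢.Adelic} {f : W.toSubmodule} :
    W.conjEquiv f ∈ W.conj.fixedVectors Kf ↔ f ∈ W.fixedVectors Kf :=
  W.mapSemilinearEquiv_mem_fixedVectors_iff _

/-- **Hecke operators commute with conjugation**: `[Kf g Kf] f̄ = \overline{[Kf g Kf] f}` for
`f ∈ W^{Kf}`. [folklore] -/
theorem heckeOperatorAt_conj_conjEquiv (Kf : Subgroup 𝒢.Adelic) (g : 𝒢.Adelic) {f : W.toSubmodule}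
    (hf : f ∈ W.fixedVectors Kf) :
    heckeOperatorAt W.conj Kf g (W.conjEquiv f) = W.conjEquiv (heckeOperatorAt W Kf g f) :=
  W.heckeOperatorAt_mapSemilinear_mapSemilinearEquiv _ Kf g hf

end ContRepresentation.ClosedSubrep

/-! ### `GL_n`: conjugates of cusp forms and of cuspidal automorphic representations -/

namespace Literature.NumberTheory.Automorphic

open AdelicGroupData ContRepresentation

section CuspForms

variable {n : ℕ} {K : Type} [Field K] [NumberField K]

/-- Conjugation preserves the vanishing of constant terms: `∫ φ̄(x u) du = \overline{∫ φ(x u) du}`.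
[folklore] -/
theorem ConstantTermVanishes.star {φ : (gl n K).automorphicQuotient → ℂ} {k : ℕ}
    (hφ : ConstantTermVanishes n K φ k) : ConstantTermVanishes n K (star φ) k := by
  intro ν _ 𝓕 h𝓕 x
  obtain ⟨hi, h0⟩ := hφ ν 𝓕 h𝓕 x
  refine ⟨?_, ?_⟩
  · have := (memLp_one_iff_integrable.2 hi).star
    exact memLp_one_iff_integrable.1 this
  · simp only [Pi.star_apply, RCLike.star_def]
    rw [integral_conj, h0, map_zero]

variable (μ : Measure (gl n K).automorphicQuotient)

/-- **Conjugates of continuous cusp forms are continuous cusp forms.** [folklore] -/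
theorem star_mem_cuspForms {φ : (gl n K).automorphicQuotient → ℂ} (hφ : φ ∈ cuspForms n K μ) :
    star φ ∈ cuspForms n K μ :=
  ⟨hφ.1.star, hφ.2.1.star, fun k hk hkn => (hφ.2.2 k hk hkn).star⟩

/-- Conjugation maps the image of `cuspForms` in `L²` into itself. [folklore] -/
theorem conjL2_mem_range_cuspFormsToLp {f : (gl n K).L2 μ}
    (hf : f ∈ LinearMap.range (cuspFormsToLp n K μ)) :
    (gl n K).conjL2 μ f ∈ LinearMap.range (cuspFormsToLp n K μ) := by
  obtain ⟨φ, rfl⟩ := hf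
  refine ⟨⟨star (φ : (gl n K).automorphicQuotient → ℂ), star_mem_cuspForms μ φ.2⟩, ?_⟩
  rw [cuspFormsToLp_apply, cuspFormsToLp_apply, conjL2_toLp]

variable [SMulInvariantMeasure (gl n K).Adelic (gl n K).automorphicQuotient μ]

/-- **Conjugation preserves the cuspidal subspace** `L²_cusp`. [folklore] -/
theorem conjL2_mem_cuspidalSubspace {f : (gl n K).L2 μ} (hf : f ∈ cuspidalSubspace n K μ) :
    (gl n K).conjL2 μ f ∈ cuspidalSubspace n K μ := by
  have hmaps : Set.MapsTo ((gl n K).conjL2 μ)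
      (LinearMap.range (cuspFormsToLp n K μ) : Set ((gl n K).L2 μ))
      (LinearMap.range (cuspFormsToLp n K μ) : Set ((gl n K).L2 μ)) :=
    fun f hf => conjL2_mem_range_cuspFormsToLp μ hf
  have hcl := hmaps.closure ((gl n K).conjL2 μ).continuous
  have hf' : f ∈ closure (LinearMap.range (cuspFormsToLp n K μ) : Set ((gl n K).L2 μ)) := by
    rw [← Submodule.topologicalClosure_coe]; exact hf
  have := hcl hf'
  rw [← Submodule.topologicalClosure_coe] at this
  exact this

/-- The conjugate of a subrepresentation of `L²_cusp` lies in `L²_cusp`. [folklore] -/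
theorem conj_le_cuspidalSubspace {W : ClosedSubrep ((gl n K).rightRegular μ)}
    (hW : W ≤ cuspidalSubspace n K μ) : W.conj ≤ cuspidalSubspace n K μ := by
  intro f hf
  rw [ClosedSubrep.mem_conj_iff] at hf
  have := conjL2_mem_cuspidalSubspace μ (hW hf)
  rwa [conjL2_apply, star_star] at this

variable {μ}

/-- **The complex conjugate `π̄` of a cuspidal automorphic representation** `π` of `GL_n(𝔸_K)`:
the closed irreducible subspace `{f̄ : f ∈ π} ≤ L²_cusp`. Since `π` is unitary, `π̄` realises the
contragredient `π̃` (the representation on the conjugate Hilbert space); its Hecke matrices are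
the complex conjugates `\bar t_{π,v}` — for unitary unramified `π_v` the "adjoint" of `t_{π,v}` used by
Arthur–Clozel (Ch. 3, proof of Thm. 3.1, p. 172: "`t̃'_v` denoting the adjoint of `t'_v`").
[cite: ArthurClozelAMS120, Ch. 3 §2–§3 (`σ̃`, `t̃_v`)] -/
def CuspidalAutomorphicRepGL.conj (P : CuspidalAutomorphicRepGL n K μ) : CuspidalAutomorphicRepGL n K μ :=
  ⟨P.1.conj, conj_le_cuspidalSubspace μ P.2.1, P.1.isTopIrreducible_conj_iff.mpr P.2.2⟩

/-- The underlying closed subrepresentation of `P.conj` is `P.1.conj` (definitional). [folklore] -/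
@[simp] theorem CuspidalAutomorphicRepGL.conj_val (P : CuspidalAutomorphicRepGL n K μ) :
    P.conj.1 = P.1.conj := rfl

/-- `conj (conj π) = π`. [folklore] -/
@[simp] theorem CuspidalAutomorphicRepGL.conj_conj (P : CuspidalAutomorphicRepGL n K μ) :
    P.conj.conj = P :=
  Subtype.ext P.1.conj_conj

/-- `π ↦ π̄` is injective. [folklore] -/
theorem CuspidalAutomorphicRepGL.conj_injective :
    Function.Injective (CuspidalAutomorphicRepGL.conj : CuspidalAutomorphicRepGL n K μ → _) :=
  fun P Q h => by rw [← P.conj_conj, h, Q.conj_conj]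

/-- `π̄ = π' ↔ π = π̄'`. [folklore] -/
theorem CuspidalAutomorphicRepGL.conj_eq_iff_eq_conj {P Q : CuspidalAutomorphicRepGL n K μ} :
    P.conj = Q ↔ P = Q.conj := by
  constructor
  · rintro rfl; rw [P.conj_conj]
  · rintro rfl; rw [Q.conj_conj]

/-! ### Satake parameters of the conjugate: `t_{π̄,v} = \bar t_{π,v}` -/

/-- Elementary symmetric functions commute with ring homomorphisms:
`e_i(f(s)) = f(e_i(s))`. [folklore] -/
theorem _root_.Multiset.esymm_map_ringHom {R S : Type*} [CommSemiring R] [CommSemiring S]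
    (f : R →+* S) (s : Multiset R) (i : ℕ) : (s.map f).esymm i = f (s.esymm i) := by
  simp only [Multiset.esymm, Multiset.powersetCard_map, Multiset.map_map, Function.comp_def,
    map_multiset_sum, ← Multiset.prod_hom]

/-- **Satake parameters of the conjugate representation**: if `W` has Satake parameter `α` at `v`
(level `Kf`, uniformiser `ϖ`) then `W̄` has Satake parameter `ᾱ = {ā : a ∈ α}` there — the Hecke
operators are real (sums of translates) and commute with conjugation, so the eigenvalues
`q_v^{i(n-i)/2} e_i(α)` become their conjugates `q_v^{i(n-i)/2} e_i(ᾱ)`. For unitary `π_v` this is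
the Satake parameter of `π̃_v ≅ π̄_v` (Arthur–Clozel, Ch. 3, p. 172, "adjoint of `t_v`").
[folklore] -/
theorem HasSatakeParameterAt.conj {W : ClosedSubrep ((gl n K).rightRegular μ)}
    {Kf : Subgroup (gl n K).Adelic} {v : HeightOneSpectrum (𝓞 K)} {ϖ : (v.adicCompletion K)ˣ}
    {α : Multiset ℂ} (h : HasSatakeParameterAt W Kf v ϖ α) :
    HasSatakeParameterAt W.conj Kf v ϖ (α.map (starRingEnd ℂ)) := by
  obtain ⟨hϖ, hcard, f, hf, hf0, heig⟩ := h
  refine ⟨hϖ, by rw [Multiset.card_map, hcard], W.conjEquiv f,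
    W.conjEquiv_mem_fixedVectors_iff.2 hf, ?_, fun i hi => ?_⟩
  · intro h0
    apply hf0
    apply W.conjEquiv.injective
    rw [h0, map_zero]
  · rw [W.heckeOperatorAt_conj_conjEquiv Kf _ hf, heig i hi, map_smulₛₗ, map_mul, map_pow,
      Complex.conj_ofReal, Multiset.esymm_map_ringHom]

/-- Conversely (apply `conj` twice). [folklore] -/
theorem HasSatakeParameterAt.of_conj {W : ClosedSubrep ((gl n K).rightRegular μ)}
    {Kf : Subgroup (gl n K).Adelic} {v : HeightOneSpectrum (𝓞 K)} {ϖ : (v.adicCompletion K)ˣ}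
    {α : Multiset ℂ} (h : HasSatakeParameterAt W.conj Kf v ϖ α) :
    HasSatakeParameterAt W Kf v ϖ (α.map (starRingEnd ℂ)) := by
  simpa only [ClosedSubrep.conj_conj] using h.conj

/-- `W̄` has Satake parameter `α` iff `W` has Satake parameter `ᾱ`. [folklore] -/
theorem hasSatakeParameterAt_conj_iff {W : ClosedSubrep ((gl n K).rightRegular μ)}
    {Kf : Subgroup (gl n K).Adelic} {v : HeightOneSpectrum (𝓞 K)} {ϖ : (v.adicCompletion K)ˣ}
    {α : Multiset ℂ} :
    HasSatakeParameterAt W.conj Kf v ϖ α ↔ HasSatakeParameterAt W Kf v ϖ (α.map (starRingEnd ℂ)) := by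
  refine ⟨HasSatakeParameterAt.of_conj, fun h => ?_⟩
  have := h.conj
  rwa [Multiset.map_map, show (starRingEnd ℂ) ∘ (starRingEnd ℂ) = id from
    funext fun z => Complex.conj_conj z, Multiset.map_id] at this

/-- `W̄` is unramified at `v` iff `W` is. [folklore] -/
theorem isUnramifiedAt_conj_iff {W : ClosedSubrep ((gl n K).rightRegular μ)}
    {v : HeightOneSpectrum (𝓞 K)} : IsUnramifiedAt W.conj v ↔ IsUnramifiedAt W v := by
  constructor
  · rintro ⟨𝔫, h𝔫, hv, ϖ, α, h⟩
    exact ⟨𝔫, h𝔫, hv, ϖ, _, h.of_conj⟩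
  · rintro ⟨𝔫, h𝔫, hv, ϖ, α, h⟩
    exact ⟨𝔫, h𝔫, hv, ϖ, _, h.conj⟩

end CuspForms

section Family

variable {n : ℕ} {K : Type} [Field K] [NumberField K] {μ : Measure (gl n K).automorphicQuotient}
  [(gl n K).IsAutomorphicMeasure μ]

/-- **Satake families of the conjugate**: if `α` is a Satake family of `π` away from `S`, then
`v ↦ \bar{α(v)}` is a Satake family of `π̄` away from `S` (`t_{π̃,v} = \bar t_{π,v}` for unitary
cuspidal `π`; Arthur–Clozel, Ch. 3, p. 172). [folklore] -/
theorem IsSatakeFamilyOf.conj {P : CuspidalAutomorphicRepGL n K μ} {S : Set (HeightOneSpectrum (𝓞 K))}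
    {α : SatakeFamily K} (h : IsSatakeFamilyOf P S α) :
    IsSatakeFamilyOf P.conj S fun v => (α v).map (starRingEnd ℂ) := by
  intro v hv
  obtain ⟨𝔫, h𝔫, hv𝔫, ϖ, hα⟩ := h v hv
  exact ⟨𝔫, h𝔫, hv𝔫, ϖ, hα.conj⟩

/-- Conversely, a Satake family of `π̄` conjugates to one of `π`. [folklore] -/
theorem IsSatakeFamilyOf.of_conj {P : CuspidalAutomorphicRepGL n K μ}
    {S : Set (HeightOneSpectrum (𝓞 K))} {α : SatakeFamily K} (h : IsSatakeFamilyOf P.conj S α) :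
    IsSatakeFamilyOf P S fun v => (α v).map (starRingEnd ℂ) := by
  simpa only [CuspidalAutomorphicRepGL.conj_conj] using h.conj

end Family

end Literature.NumberTheory.Automorphic
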